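import Summits.AtomisticToContinuum.Crystallization.Theorems.OverbindingBudgetCleanTwoShellCut

/-!
# OverbindingBudget — B₁ᵇ re-typed as a TWO-SHELL local rigidity statement: transfer through an `ε`-matching (lens-4 g28, part IXa)

Helper file (`--supports stmt-AtomisticToContinuum-31280`).  Critic row 418 (1) ruled that the rigidity half B₁ᵇ of the bridge piece
B₁ `CleanTwoShell` must NOT be read as single-shell tolerant kissing rigidity: the tree refutations `not_krShape12` (p817414) and `not_kr`
(p817578) exhibit a twisted dozen that is `1/100`-charge-free with a gapped shell yet deviates from both patterns by `≍ √θ > 1/16`.  Inside a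
CLEAN TEXTURE the second shell (the neighbours' own `RT` shells) caps the six squares, so the honest local statement is TWO-SHELL and its
hypothesis is a charge-free `3`-BALL of a clean texture.  This file types that local statement and PROVES the passage from it to the limit
form, leaving for the certificate exactly one finite local claim.

* `IsTwoShellGoodSetGap ε g aLo aHi Y q` (§1): `IsTwoShellGoodSet` with the covering clause extended to radius `3/2·a + g` (a texture whose
  more distant atoms start beyond `1.57·a` has a small slack `g` for free); `g = 0` is the Literature predicate (`isTwoShellGoodSet_of_gap`).
* `ChargeFreeBallNear Y q ε` (§1): as `ChargeFreeNear`, but the recurring chunk site `y i` is `7`-deep and EVERY chunk site within `3` of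
  it is charge-free.  `LimitChargeFreeBall T₀ D` (every site is such a limit; PROVED in part IXb) and
  `ChargeFreeBallRigidity T₀ D` (such a limit site is `(1/16, 9/10, 1)`-good) cut B₁ exactly as before (`cleanTwoShell_of_ballPieces`).
* **`LocalTwoShellRigidity T₀ D`** (§1) — THE CERTIFICATE TARGET: in an uncompressed clean texture, a `7`-deep chunk site whose `3`-ball is
  `1/100`-charge-free is `(3/50, gap 1/500, 9/10, 1)`-two-shell-good (the loosest tolerance the transfer carries to `1/16`).  [= critic's GRAPH-ID «capped contact graph is cubocta / anticubocta»
  ∧ KR2-LOCAL «capped graph ⇒ deviation law», in lens-5 / census vocabulary; UNDECIDED·TRUE-type, certificate-class.] [piece]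
* **TRANSFER, PROVED** (§2 `isTwoShellGoodSet_of_match`): if `p` is `(η, g, aLo, aHi)`-good with gap, `Y` is `δ₀`-separated, and `Y − p`
  is `ε`-matched to `Y − q` on `B(0, 3)` with `2ε < δ₀`, `ε ≤ g`, `2ε < aLo(1 − 2η)`, then `q` is `(η + ε/aLo, aLo, aHi)`-good: the chart
  is pushed through the matching; injectivity from the `1`-separation of the patterns, covering from the gap.
* **SEAM, PROVED** (§3 `chargeFreeBallRigidity_of_local`, `T₀ ≤ 1/2`): `LocalTwoShellRigidity T₀ D → ChargeFreeBallRigidity T₀ D`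
  (`ε = 1/500`: `3/50 + (1/500)/(9/10) = 14/225 < 1/16`; separation `δ₀ = (47/50)(49/50) − T₀` from `RT`).
-/

namespace Summit.AtomisticToContinuum.Crystallization.Theorems.OverbindingBudgetTwoShellTransfer

open scoped Classical
open Literature.MathematicalPhysics.StatisticalMechanics (UniformlyDiscrete Match)
open Literature.Geometry.DiscreteGeometry (IsTwoShellGoodSet IsChargeFree fccTwoShellPattern hcpTwoShellPattern
  norm_le_sqrt_two_of_mem_twoShellPattern one_le_dist_of_mem_fccTwoShellPattern one_le_dist_of_mem_hcpTwoShellPattern)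
open Summit.AtomisticToContinuum.Crystallization.Theorems.OverbindingBudgetViolatorDensityFloor (RT)
open Summit.AtomisticToContinuum.Crystallization.Theorems.OverbindingBudgetEdgeRelaxationStatements (CleanClass)
open Summit.AtomisticToContinuum.Crystallization.Theorems.OverbindingBudgetElasticSplitStatements (SparseCharge)
open Summit.AtomisticToContinuum.Crystallization.Theorems.OverbindingBudgetElasticSplitScale (HasCompressedScale)
open Summit.AtomisticToContinuum.Crystallization.Theorems.OverbindingBudgetElasticSplitDoorBridge (CleanTwoShell)
open Summit.AtomisticToContinuum.Crystallization.Theorems.OverbindingBudgetCleanTwoShellCut (ChargeFreeNear ChargeFreeRigidity)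

/-! ## §1 The statements -/

/-- `IsTwoShellGoodSet` with the covering clause out to radius `3/2·a + g`. -/
def IsTwoShellGoodSetGap (ε g aLo aHi : ℝ) (Y : Set (EuclideanSpace ℝ (Fin 3))) (q : EuclideanSpace ℝ (Fin 3)) : Prop :=
  ∃ a : ℝ, aLo ≤ a ∧ a ≤ aHi ∧ ∃ (A : EuclideanSpace ℝ (Fin 3) →ₗᵢ[ℝ] EuclideanSpace ℝ (Fin 3)) (P : Finset (EuclideanSpace ℝ (Fin 3)))
    (f : EuclideanSpace ℝ (Fin 3) → EuclideanSpace ℝ (Fin 3)), (P = fccTwoShellPattern ∨ P = hcpTwoShellPattern) ∧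
    (∀ v ∈ P, f v ∈ Y ∧ dist (f v) (q + a • A v) ≤ ε * a) ∧ Set.InjOn f ↑P ∧
    ∀ y ∈ Y, y ≠ q → dist y q ≤ 3 / 2 * a + g → ∃ v ∈ P, f v = y

/-- A non-negative gap only strengthens goodness. [folklore] -/
theorem isTwoShellGoodSet_of_gap {ε g aLo aHi : ℝ} {Y : Set (EuclideanSpace ℝ (Fin 3))} {q : EuclideanSpace ℝ (Fin 3)}
    (h : IsTwoShellGoodSetGap ε g aLo aHi Y q) (hg : 0 ≤ g) : IsTwoShellGoodSet ε aLo aHi Y q := by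
  obtain ⟨a, ha₁, ha₂, A, P, f, hP, hf, hinj, hcov⟩ := h
  exact ⟨a, ha₁, ha₂, A, P, f, hP, hf, hinj, fun y hy hyq hd => hcov y hy hyq (by linarith)⟩

/-- **`ChargeFreeBallNear Y q ε`**: some injectively enumerated cube chunk of `Y` has a `7`-deep site `y i` all of whose chunk sites within
`3` are `1/100`-charge-free, with `Y − y i` two-way `ε`-matched to `Y − q` on `B(0, 3)`. -/
def ChargeFreeBallNear (Y : Set (EuclideanSpace ℝ (Fin 3))) (q : EuclideanSpace ℝ (Fin 3)) (ε : ℝ) : Prop :=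
  ∃ c : EuclideanSpace ℝ (Fin 3), ∃ ℓ : ℝ, ∃ N : ℕ, ∃ y : Fin N → EuclideanSpace ℝ (Fin 3), ∃ i : Fin N,
    Function.Injective y ∧ Set.range y = Y ∩ {z | ∀ j : Fin 3, c j ≤ z j ∧ z j < c j + ℓ} ∧
    (∀ j : Fin 3, c j + 7 ≤ y i j ∧ y i j + 7 ≤ c j + ℓ) ∧ (∀ i' : Fin N, dist (y i') (y i) ≤ 3 → IsChargeFree (1 / 100 : ℝ) y i') ∧
    Match ε 3 0 ((fun p => p - y i) '' Y) ((fun p => p - q) '' Y)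

/-- A charge-free ball near `q` is in particular a charge-free site near `q`. [this file] -/
theorem chargeFreeNear_of_ball {Y : Set (EuclideanSpace ℝ (Fin 3))} {q : EuclideanSpace ℝ (Fin 3)} {ε : ℝ}
    (h : ChargeFreeBallNear Y q ε) : ChargeFreeNear Y q ε := by
  obtain ⟨c, ℓ, N, y, i, hinj, hr, hdeep, hfree, hM⟩ := h
  refine ⟨c, ℓ, N, y, i, hinj, hr, fun j => ⟨by linarith [(hdeep j).1], by linarith [(hdeep j).2]⟩, hfree i (by simp), hM⟩

/-- **B₁ᵃ⁺ · `LimitChargeFreeBall T₀ D`**: in a clean texture with sparse charge every site is an `ε`-limit of charge-free BALLS, for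
every `ε > 0`.  PROVED in part IXb. [piece] -/
def LimitChargeFreeBall (T₀ D : ℝ) : Prop :=
  ∀ Y : Set (EuclideanSpace ℝ (Fin 3)), CleanClass T₀ D Y → SparseCharge Y → ∀ q ∈ Y, ∀ ε : ℝ, 0 < ε → ChargeFreeBallNear Y q ε

/-- **`ChargeFreeBallRigidity T₀ D`**: a site of an uncompressed clean texture that is a limit of charge-free balls is (1/16, 9/10, 1)-good.
Implied by `ChargeFreeRigidity` (weaker hypothesis there) and by `LocalTwoShellRigidity` (§3). [piece] -/
def ChargeFreeBallRigidity (T₀ D : ℝ) : Prop :=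
  ∀ Y : Set (EuclideanSpace ℝ (Fin 3)), CleanClass T₀ D Y → ¬ HasCompressedScale T₀ Y →
    ∀ q ∈ Y, (∀ ε : ℝ, 0 < ε → ChargeFreeBallNear Y q ε) → IsTwoShellGoodSet (1 / 16) (9 / 10) 1 Y q

/-- **`LocalTwoShellRigidity T₀ D`** — the certificate target (TWO-SHELL; the single-shell reading is excluded by `not_krShape12` /
`not_kr`): in an uncompressed clean texture a `7`-deep chunk site whose `3`-ball is `1/100`-charge-free is `(3/50, gap 1/500, 9/10, 1)`-good.
UNDECIDED·TRUE-type. [piece] -/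
def LocalTwoShellRigidity (T₀ D : ℝ) : Prop :=
  ∀ Y : Set (EuclideanSpace ℝ (Fin 3)), CleanClass T₀ D Y → ¬ HasCompressedScale T₀ Y →
    ∀ (c : EuclideanSpace ℝ (Fin 3)) (ℓ : ℝ) (N : ℕ) (y : Fin N → EuclideanSpace ℝ (Fin 3)) (i : Fin N),
      Function.Injective y → Set.range y = Y ∩ {z | ∀ j : Fin 3, c j ≤ z j ∧ z j < c j + ℓ} →
      (∀ j : Fin 3, c j + 7 ≤ y i j ∧ y i j + 7 ≤ c j + ℓ) → (∀ i' : Fin N, dist (y i') (y i) ≤ 3 → IsChargeFree (1 / 100 : ℝ) y i') →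
      IsTwoShellGoodSetGap (3 / 50) (1 / 500) (9 / 10) 1 Y (y i)

/-- The landed single-site interface implies the ball interface. [this file] -/
theorem chargeFreeBallRigidity_of_chargeFreeRigidity {T₀ D : ℝ} (h : ChargeFreeRigidity T₀ D) : ChargeFreeBallRigidity T₀ D :=
  fun Y hY hnc q hq hb => h Y hY hnc q hq fun ε hε => chargeFreeNear_of_ball (hb ε hε)

/-- **Seam.** `LimitChargeFreeBall → ChargeFreeBallRigidity → CleanTwoShell`. [this file] -/
theorem cleanTwoShell_of_ballPieces {T₀ D : ℝ} (ha : LimitChargeFreeBall T₀ D) (hb : ChargeFreeBallRigidity T₀ D) : CleanTwoShell T₀ D :=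
  fun Y hY hnc hsc _ _ q hq => hb Y hY hnc q hq fun ε hε => ha Y hY hsc q hq ε hε

/-! ## §2 Transfer of two-shell goodness through an `ε`-matching -/

set_option maxHeartbeats 1600000 in
/-- **Transfer.**  Goodness with gap at `p` plus a two-way `ε`-matching of `Y − p` with `Y − q` on `B(0, 3)` gives goodness at `q` with
tolerance `η + ε/aLo`, in a `δ₀`-separated `Y` (`2ε < δ₀`, `ε ≤ g`, `2ε < aLo(1 − 2η)`, `aHi ≤ 1`, `η ≤ 1/4`). [this file] -/
theorem isTwoShellGoodSet_of_match {Y : Set (EuclideanSpace ℝ (Fin 3))} {p q : EuclideanSpace ℝ (Fin 3)} {η g aLo aHi ε η' δ₀ : ℝ}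
    (hsep : ∀ x ∈ Y, ∀ y ∈ Y, x ≠ y → δ₀ ≤ dist x y) (hq : q ∈ Y) (hp : IsTwoShellGoodSetGap η g aLo aHi Y p)
    (hM : Match ε 3 0 ((fun x => x - p) '' Y) ((fun x => x - q) '' Y)) (hε : 0 ≤ ε) (h2ε : 2 * ε < δ₀) (hεg : ε ≤ g) (haLo : 0 < aLo)
    (haHi : aHi ≤ 1) (hη0 : 0 ≤ η) (hη1 : η ≤ 1 / 4) (hinj : 2 * ε < aLo * (1 - 2 * η)) (hη' : η + ε / aLo ≤ η') :
    IsTwoShellGoodSet η' aLo aHi Y q := by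
  obtain ⟨a, ha₁, ha₂, A, P, f, hP, hf, hinjf, hcov⟩ := hp
  have ha0 : 0 < a := haLo.trans_le ha₁
  have ha1 : a ≤ 1 := ha₂.trans haHi
  have hsqrt : Real.sqrt 2 ≤ 3 / 2 := by
    rw [show (3 / 2 : ℝ) = Real.sqrt ((3 / 2) ^ 2) from (Real.sqrt_sq (by norm_num)).symm]
    exact Real.sqrt_le_sqrt (by norm_num)
  -- the pattern images lie in `B(p, 3)`
  have hfp : ∀ v ∈ P, dist (f v - p) 0 ≤ 3 := by
    intro v hv
    have h1 : ‖a • A v‖ ≤ 3 / 2 := by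
      rw [norm_smul, Real.norm_eq_abs, abs_of_pos ha0, A.norm_map]
      have := norm_le_sqrt_two_of_mem_twoShellPattern hP hv
      nlinarith [norm_nonneg v]
    have h2 : dist (f v) (p + a • A v) ≤ η * a := (hf v hv).2
    rw [dist_zero_right]
    have e : f v - p = (f v - (p + a • A v)) + a • A v := by abel
    rw [e]
    have h3 : ‖f v - (p + a • A v)‖ ≤ η * a := by rwa [← dist_eq_norm]
    have h4 : η * a ≤ 1 := by nlinarith
    exact (norm_add_le _ _).trans (by linarith)
  -- push the chart through the matching
  have key : ∀ v ∈ P, ∃ y ∈ Y, dist (f v - p) (y - q) ≤ ε := by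
    intro v hv
    obtain ⟨s, ⟨y, hy, rfl⟩, hd⟩ := hM.2 (f v - p) ⟨f v, (hf v hv).1, rfl⟩ (hfp v hv)
    exact ⟨y, hy, hd⟩
  choose! f' hf'Y hf'd using key
  refine ⟨a, ha₁, ha₂, A, P, f', hP, fun v hv => ⟨hf'Y v hv, ?_⟩, ?_, ?_⟩
  · -- tolerance
    have h1 : dist (f v) (p + a • A v) ≤ η * a := (hf v hv).2
    have h2 := hf'd v hv
    rw [dist_eq_norm] at h1 h2 ⊢
    have e : f' v - (q + a • A v) = (f v - (p + a • A v)) - (f v - p - (f' v - q)) := by abel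
    rw [e]
    have h3 : ε ≤ ε / aLo * a := by
      rw [div_mul_eq_mul_div, le_div_iff₀ haLo]
      exact mul_le_mul_of_nonneg_left ha₁ hε
    have h4 : (η + ε / aLo) * a ≤ η' * a := mul_le_mul_of_nonneg_right hη' ha0.le
    calc ‖(f v - (p + a • A v)) - (f v - p - (f' v - q))‖ ≤ η * a + ε := (norm_sub_le _ _).trans (add_le_add h1 h2)
      _ ≤ η' * a := by nlinarith
  · -- injectivity
    intro v hv w hw hvw
    by_contra hne
    have h1 : 1 ≤ dist v w := by
      rcases hP with rfl | rfl
      · exact one_le_dist_of_mem_fccTwoShellPattern hv hw hne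
      · exact one_le_dist_of_mem_hcpTwoShellPattern hv hw hne
    have h2 : dist (a • A v) (a • A w) = a * dist v w := by
      rw [dist_eq_norm, ← smul_sub, norm_smul, Real.norm_eq_abs, abs_of_pos ha0, ← map_sub, A.norm_map, dist_eq_norm]
    have h3 : dist (f v) (f w) ≤ 2 * ε := by
      have e : dist (f v) (f w) = dist (f v - p) (f w - p) := by simp [dist_eq_norm]
      rw [e]
      calc dist (f v - p) (f w - p) ≤ dist (f v - p) (f' v - q) + dist (f' v - q) (f w - p) := dist_triangle _ _ _
        _ ≤ ε + ε := by
            refine add_le_add (hf'd v hv) ?_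
            rw [hvw, dist_comm]; exact hf'd w hw
        _ = 2 * ε := by ring
    have h4 : a * dist v w ≤ dist (f v) (f w) + 2 * (η * a) := by
      rw [← h2]
      have t1 : dist (f v) (p + a • A v) ≤ η * a := (hf v hv).2
      have t2 : dist (f w) (p + a • A w) ≤ η * a := (hf w hw).2
      have e : dist (a • A v) (a • A w) = dist (p + a • A v) (p + a • A w) := by simp [dist_eq_norm]
      rw [e]
      have := dist_triangle4 (p + a • A v) (f v) (f w) (p + a • A w)
      rw [dist_comm] at t1
      linarith
    have h5 : aLo * (1 - 2 * η) ≤ a * (1 - 2 * η) := mul_le_mul_of_nonneg_right ha₁ (by linarith)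
    nlinarith
  · -- covering
    intro y hy hyq hd
    have hy0 : dist (y - q) 0 ≤ 3 := by
      rw [dist_zero_right, ← dist_eq_norm]; nlinarith
    obtain ⟨s, ⟨y', hy', rfl⟩, hd'⟩ := hM.1 (y - q) ⟨y, hy, rfl⟩ hy0
    have hy'p : y' ≠ p := by
      rintro rfl
      have h1 : dist y q ≤ ε := by
        have h := hd'
        simp only [sub_self] at h
        rwa [dist_comm, dist_zero_right, ← dist_eq_norm] at h
      have h2 := hsep y hy q hq hyq
      linarith
    have hd'' : dist y' p ≤ 3 / 2 * a + g := by
      have e : dist y' p = ‖y' - p‖ := dist_eq_norm _ _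
      rw [dist_eq_norm] at hd hd'
      have : ‖y' - p‖ ≤ ‖y' - p - (y - q)‖ + ‖y - q‖ := norm_le_norm_sub_add _ _
      linarith
    obtain ⟨v, hv, hfv⟩ := hcov y' hy' hy'p hd''
    refine ⟨v, hv, ?_⟩
    by_contra hne
    have h1 := hsep (f' v) (hf'Y v hv) y hy hne
    have h2 : dist (f' v) y ≤ 2 * ε := by
      have e : dist (f' v) y = dist (f' v - q) (y - q) := by simp [dist_eq_norm]
      rw [e]
      have t1 : dist (f v - p) (f' v - q) ≤ ε := hf'd v hv
      rw [hfv] at t1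
      calc dist (f' v - q) (y - q) ≤ dist (f' v - q) (y' - p) + dist (y' - p) (y - q) := dist_triangle _ _ _
        _ ≤ ε + ε := add_le_add (by rw [dist_comm]; exact t1) hd'
        _ = 2 * ε := by ring
    linarith

/-! ## §3 The seam: local rigidity gives the limit rigidity -/

/-- Separation of a clean texture: distinct sites are `(47/50)(49/50) − T₀` apart. [this file] -/
theorem sep_of_cleanClass {T₀ D : ℝ} {Y : Set (EuclideanSpace ℝ (Fin 3))} (hY : CleanClass T₀ D Y) :
    ∀ x ∈ Y, ∀ y ∈ Y, x ≠ y → 47 / 50 * (49 / 50) - T₀ ≤ dist x y := by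
  obtain ⟨a, ha₁, -, hRT⟩ := hY.2.2.2.2.2
  intro x hx y hy hxy
  have h := ((hRT x hx).2.2 y hy (Ne.symm hxy)).1
  nlinarith

/-- **Seam, PROVED.** `LocalTwoShellRigidity T₀ D → ChargeFreeBallRigidity T₀ D` for `T₀ ≤ 1/2` (`ε = 1/500`). [this file] -/
theorem chargeFreeBallRigidity_of_local {T₀ D : ℝ} (hT : T₀ ≤ 1 / 2) (hloc : LocalTwoShellRigidity T₀ D) :
    ChargeFreeBallRigidity T₀ D := by
  intro Y hY hnc q hq hlim
  obtain ⟨c, ℓ, N, y, i, hinj, hr, hdeep, hfree, hM⟩ := hlim (1 / 500) (by norm_num)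
  have hgood := hloc Y hY hnc c ℓ N y i hinj hr hdeep hfree
  have hsep := sep_of_cleanClass hY
  exact isTwoShellGoodSet_of_match hsep hq hgood hM (by norm_num) (by linarith) (by norm_num) (by norm_num) le_rfl (by norm_num)
    (by norm_num) (by norm_num) (by norm_num)

end Summit.AtomisticToContinuum.Crystallization.Theorems.OverbindingBudgetTwoShellTransfer
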